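import Mathlib
import Literature.Analysis.FluidPDE.NewtonPotentialHolder
import Literature.Analysis.FluidPDE.NewtonGradientPotential

/-!
# Route `FilamentSkeletonRss` · crux `TransverseReductionRJ` (stmt-NavierStokesRegularity-21221) — line `kelvin_gate`,
# stub S2′ `EventualKelvinGate`: DECAY OF THE FREE PRESSURE — the dipole potential of a `⟨y⟩⁻²` density

Helper file (theorems only, `--supports stmt-NavierStokesRegularity-21221 --as helper`).  HONEST FRAMING: analysis
bookkeeping for a HYPOTHETICAL filament-type rotating-self-similar blow-up route; nothing here bears on Navier–Stokes
regularity; no stub is proved here.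

The free Kelvin gate on ALL of `Y` (data `F ∈ C¹` with `(1+|y|)² |F| ≤ R`) carries the pressure `Q = Σⱼ ∂ⱼΓ ⋆ Fⱼ`
(`ΔQ = div F`; evidence #28 PRESSURE-STEP-DESIGN, route R1 step (P1)).  The densities `Fⱼ` are NOT integrable at this
decay, so the tree's compact-support / `L¹` potential theory (`NewtonGradientPotential`, `NewtonPotentialFarField`) does
not apply as is; what makes `Q` converge and stay bounded (indeed decay) is the weighted estimate of this file:

* `lintegral_norm_sub_rpow_neg_two_mul_inv_weight_sq_le` — **`∫ |x − y|⁻² (1+|y|)⁻² dy ≤ 12 V/(1+|x|)`**,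
  `V = 3|B₁| = 4π` (split `ℝ³` into the ball `B(x,(1+|x|)/2)`, the rest of `B(0,2(1+|x|))`, and the exterior;
  the radial integrals are the tree's `lintegral_ball_norm_rpow_neg` / `lintegral_compl_ball_norm_rpow_neg`);
* `integrable_fderiv_newtonKernel_mul_of_sq_weight`, `abs_newtonGradPotential_le_of_sq_weight` — hence for a
  measurable real density with `(1+|y|)²|f| ≤ R` the dipole potential `T_a f(x) = ∫ ∂ₐΓ(x − y) f(y) dy`
  (`newtonGradPotential`) converges absolutely and **`|T_a f(x)| ≤ (12V/4π) ‖a‖ R/(1+|x|)`**: the free pressure of the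
  gate is bounded (GateSpec asks `|Q| ≤ C R`) and even `O(1/|y|)`.
-/

set_option linter.dupNamespace false

noncomputable section

namespace Summit.NavierStokesRegularity.NavierStokesRegularity.Theorems.KelvinGate

open Set Function Filter MeasureTheory Metric Real
open Literature.Analysis.FluidPDE Literature.Analysis.FluidPDE.NewtonPotentialHolder
open scoped ENNReal Topology

/-! ## Pointwise bounds on the three regions -/

/-- Near region: on `B(x, (1+|x|)/2)` the weight is comparable to its value at `x`: `(1+|y|)⁻² ≤ 4 (1+|x|)⁻²`. -/
theorem inv_weight_sq_le_of_mem_ball {x y : EuclideanSpace ℝ (Fin 3)} (hy : y ∈ ball x ((1 + ‖x‖) / 2)) :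
    ((1 + ‖y‖) ^ 2)⁻¹ ≤ 4 / (1 + ‖x‖) ^ 2 := by
  rw [mem_ball, dist_eq_norm] at hy
  have h1 : ‖x‖ - ‖y‖ ≤ ‖y - x‖ := by rw [norm_sub_rev]; exact norm_sub_norm_le x y
  have h2 : (1 + ‖x‖) / 2 ≤ 1 + ‖y‖ := by linarith
  have h3 : 0 < (1 + ‖x‖) / 2 := by linarith [norm_nonneg x]
  rw [show 4 / (1 + ‖x‖) ^ 2 = (((1 + ‖x‖) / 2) ^ 2)⁻¹ by field_simp; ring]
  exact inv_anti₀ (by positivity) (pow_le_pow_left₀ h3.le h2 2)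

/-- Off the near ball the kernel is bounded: `|x − y|⁻² ≤ 4 (1+|x|)⁻²` for `|x − y| ≥ (1+|x|)/2`. -/
theorem norm_sub_rpow_neg_two_le_of_not_mem_ball {x y : EuclideanSpace ℝ (Fin 3)} (hy : y ∉ ball x ((1 + ‖x‖) / 2)) :
    ‖x - y‖ ^ (-(2:ℝ)) ≤ 4 / (1 + ‖x‖) ^ 2 := by
  rw [mem_ball, dist_eq_norm, not_lt, norm_sub_rev] at hy
  have h3 : 0 < (1 + ‖x‖) / 2 := by linarith [norm_nonneg x]
  rw [rpow_neg (norm_nonneg _), rpow_two, show 4 / (1 + ‖x‖) ^ 2 = (((1 + ‖x‖) / 2) ^ 2)⁻¹ by field_simp; ring]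
  exact inv_anti₀ (by positivity) (pow_le_pow_left₀ h3.le hy 2)

/-- Exterior region: for `|y| ≥ 2(1+|x|)`, `|x − y|⁻² (1+|y|)⁻² ≤ 4 |y|⁻⁴`. -/
theorem norm_sub_rpow_neg_two_mul_inv_weight_sq_le_of_not_mem_ball {x y : EuclideanSpace ℝ (Fin 3)}
    (hy : y ∉ ball (0 : EuclideanSpace ℝ (Fin 3)) (2 * (1 + ‖x‖))) :
    ‖x - y‖ ^ (-(2:ℝ)) * ((1 + ‖y‖) ^ 2)⁻¹ ≤ 4 * ‖y‖ ^ (-(4:ℝ)) := by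
  rw [mem_ball_zero_iff, not_lt] at hy
  have hy0 : 0 < ‖y‖ := by linarith [norm_nonneg x]
  have h1 : ‖y‖ - ‖x‖ ≤ ‖x - y‖ := by rw [norm_sub_rev]; exact norm_sub_norm_le y x
  have h2 : ‖y‖ / 2 ≤ ‖x - y‖ := by linarith [norm_nonneg x]
  have e4 : ‖y‖ ^ (-(4:ℝ)) = (‖y‖ ^ 2)⁻¹ * (‖y‖ ^ 2)⁻¹ := by
    rw [rpow_neg hy0.le, show (4:ℝ) = ((4:ℕ):ℝ) by norm_num, rpow_natCast, ← mul_inv]; congr 1; ring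
  rw [rpow_neg (norm_nonneg _), rpow_two, e4,
    show 4 * ((‖y‖ ^ 2)⁻¹ * (‖y‖ ^ 2)⁻¹) = ((‖y‖ / 2) ^ 2)⁻¹ * (‖y‖ ^ 2)⁻¹ by field_simp; ring]
  refine mul_le_mul (inv_anti₀ (by positivity) (pow_le_pow_left₀ (by positivity) h2 2))
    (inv_anti₀ (by positivity) (pow_le_pow_left₀ hy0.le (by linarith) 2)) (by positivity) (by positivity)

/-- `(1+|y|)⁻² ≤ |y|⁻²` for `y ≠ 0`. -/
theorem inv_weight_sq_le_norm_rpow_neg_two {y : EuclideanSpace ℝ (Fin 3)} (hy : y ≠ 0) :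
    ((1 + ‖y‖) ^ 2)⁻¹ ≤ ‖y‖ ^ (-(2:ℝ)) := by
  have hy0 : 0 < ‖y‖ := norm_pos_iff.2 hy
  rw [rpow_neg hy0.le, rpow_two]
  exact inv_anti₀ (by positivity) (pow_le_pow_left₀ hy0.le (by linarith) 2)

/-! ## The weighted dipole integral -/

/-- **`∫ |x − y|⁻² (1+|y|)⁻² dy ≤ 12 V / (1 + |x|)`**, `V = 3 |B₁|` (`= 4π`), for every `x ∈ ℝ³` (in `ℝ≥0∞`). -/
theorem lintegral_norm_sub_rpow_neg_two_mul_inv_weight_sq_le (x : EuclideanSpace ℝ (Fin 3)) :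
    ∫⁻ y, ENNReal.ofReal (‖x - y‖ ^ (-(2:ℝ)) * ((1 + ‖y‖) ^ 2)⁻¹) ≤
      ENNReal.ofReal (12 * (3 * (volume : Measure (EuclideanSpace ℝ (Fin 3))).real (ball 0 1)) / (1 + ‖x‖)) := by
  set ρ : ℝ := 1 + ‖x‖ with hρ
  have hρ1 : 1 ≤ ρ := by rw [hρ]; linarith [norm_nonneg x]
  have hρ0 : 0 < ρ := by linarith
  set V : ℝ := 3 * (volume : Measure (EuclideanSpace ℝ (Fin 3))).real (ball 0 1) with hV
  have hV0 : 0 ≤ V := three_mul_volume_real_ball_nonneg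
  set f : EuclideanSpace ℝ (Fin 3) → ℝ≥0∞ := fun y => ENNReal.ofReal (‖x - y‖ ^ (-(2:ℝ)) * ((1 + ‖y‖) ^ 2)⁻¹) with hf
  set S : Set (EuclideanSpace ℝ (Fin 3)) := ball x (ρ / 2) with hS
  set T : Set (EuclideanSpace ℝ (Fin 3)) := ball (0 : EuclideanSpace ℝ (Fin 3)) (2 * ρ) with hT
  have hSm : MeasurableSet S := measurableSet_ball
  have hTm : MeasurableSet T := measurableSet_ball
  -- (1) the near ball `S`
  have h1 : ∫⁻ y in S, f y ≤ ENNReal.ofReal (2 * V / ρ) := by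
    calc ∫⁻ y in S, f y ≤ ∫⁻ y in S, ENNReal.ofReal (4 / ρ ^ 2) * ENNReal.ofReal (‖x - y‖ ^ (-(2:ℝ))) := by
          refine setLIntegral_mono' hSm fun y hy => ?_
          rw [← ENNReal.ofReal_mul (by positivity), mul_comm (4 / ρ ^ 2)]
          exact ENNReal.ofReal_le_ofReal
            (mul_le_mul_of_nonneg_left (inv_weight_sq_le_of_mem_ball hy) (rpow_nonneg (norm_nonneg _) _))
      _ = ENNReal.ofReal (4 / ρ ^ 2) * ∫⁻ y in S, ENNReal.ofReal (‖x - y‖ ^ (-(2:ℝ))) :=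
          lintegral_const_mul' _ _ ENNReal.ofReal_ne_top
      _ = ENNReal.ofReal (4 / ρ ^ 2) * ENNReal.ofReal (V * ((ρ / 2) ^ (3 - (2:ℝ)) / (3 - (2:ℝ)))) := by
          rw [hS, lintegral_ball_comp_sub_left (fun z => ENNReal.ofReal (‖z‖ ^ (-(2:ℝ)))) x (ρ / 2),
            lintegral_ball_norm_rpow_neg (by norm_num) (by positivity)]
      _ = ENNReal.ofReal (2 * V / ρ) := by
          rw [← ENNReal.ofReal_mul (by positivity)]
          congr 1
          norm_num
          field_simp
          ring
  -- (2) the annulus `Sᶜ ∩ T`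
  have hae : ∀ᵐ y ∂(volume : Measure (EuclideanSpace ℝ (Fin 3))), y ≠ 0 := by
    have h0 : (volume : Measure (EuclideanSpace ℝ (Fin 3))) {0} = 0 := measure_singleton 0
    filter_upwards [compl_mem_ae_iff.2 h0] with y hy
    simpa using hy
  have hT2 : ∫⁻ y in T, ENNReal.ofReal (((1 + ‖y‖) ^ 2)⁻¹) ≤ ENNReal.ofReal (V * (2 * ρ)) := by
    calc ∫⁻ y in T, ENNReal.ofReal (((1 + ‖y‖) ^ 2)⁻¹) ≤ ∫⁻ y in T, ENNReal.ofReal (‖y‖ ^ (-(2:ℝ))) := by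
          refine lintegral_mono_ae (ae_restrict_of_ae ?_)
          filter_upwards [hae] with y hy
          exact ENNReal.ofReal_le_ofReal (inv_weight_sq_le_norm_rpow_neg_two hy)
      _ = ENNReal.ofReal (V * ((2 * ρ) ^ (3 - (2:ℝ)) / (3 - (2:ℝ)))) := by
          rw [hT, lintegral_ball_norm_rpow_neg (by norm_num) (by positivity)]
      _ = ENNReal.ofReal (V * (2 * ρ)) := by norm_num
  have h2 : ∫⁻ y in Sᶜ ∩ T, f y ≤ ENNReal.ofReal (8 * V / ρ) := by
    calc ∫⁻ y in Sᶜ ∩ T, f y ≤ ∫⁻ y in Sᶜ ∩ T, ENNReal.ofReal (4 / ρ ^ 2) * ENNReal.ofReal (((1 + ‖y‖) ^ 2)⁻¹) := by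
          refine setLIntegral_mono' (hSm.compl.inter hTm) fun y hy => ?_
          rw [← ENNReal.ofReal_mul (by positivity)]
          exact ENNReal.ofReal_le_ofReal
            (mul_le_mul_of_nonneg_right (norm_sub_rpow_neg_two_le_of_not_mem_ball hy.1) (by positivity))
      _ = ENNReal.ofReal (4 / ρ ^ 2) * ∫⁻ y in Sᶜ ∩ T, ENNReal.ofReal (((1 + ‖y‖) ^ 2)⁻¹) :=
          lintegral_const_mul' _ _ ENNReal.ofReal_ne_top
      _ ≤ ENNReal.ofReal (4 / ρ ^ 2) * ∫⁻ y in T, ENNReal.ofReal (((1 + ‖y‖) ^ 2)⁻¹) :=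
          mul_le_mul' le_rfl (lintegral_mono_set inter_subset_right)
      _ ≤ ENNReal.ofReal (4 / ρ ^ 2) * ENNReal.ofReal (V * (2 * ρ)) := mul_le_mul' le_rfl hT2
      _ = ENNReal.ofReal (8 * V / ρ) := by
          rw [← ENNReal.ofReal_mul (by positivity)]
          congr 1
          field_simp
          ring
  -- (3) the exterior `Sᶜ \ T`
  have h3 : ∫⁻ y in Sᶜ \ T, f y ≤ ENNReal.ofReal (2 * V / ρ) := by
    calc ∫⁻ y in Sᶜ \ T, f y ≤ ∫⁻ y in Sᶜ \ T, ENNReal.ofReal 4 * ENNReal.ofReal (‖y‖ ^ (-(4:ℝ))) := by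
          refine setLIntegral_mono' (hSm.compl.diff hTm) fun y hy => ?_
          rw [← ENNReal.ofReal_mul (by norm_num)]
          exact ENNReal.ofReal_le_ofReal (norm_sub_rpow_neg_two_mul_inv_weight_sq_le_of_not_mem_ball hy.2)
      _ = ENNReal.ofReal 4 * ∫⁻ y in Sᶜ \ T, ENNReal.ofReal (‖y‖ ^ (-(4:ℝ))) :=
          lintegral_const_mul' _ _ ENNReal.ofReal_ne_top
      _ ≤ ENNReal.ofReal 4 * ∫⁻ y in Tᶜ, ENNReal.ofReal (‖y‖ ^ (-(4:ℝ))) :=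
          mul_le_mul' le_rfl (lintegral_mono_set fun y hy => hy.2)
      _ = ENNReal.ofReal 4 * ENNReal.ofReal (V * ((2 * ρ) ^ (3 - (4:ℝ)) / ((4:ℝ) - 3))) := by
          rw [hT, lintegral_compl_ball_norm_rpow_neg (by norm_num) (by positivity)]
      _ = ENNReal.ofReal (2 * V / ρ) := by
          rw [← ENNReal.ofReal_mul (by norm_num)]
          congr 1
          rw [show (3:ℝ) - 4 = -1 by norm_num, rpow_neg_one]
          field_simp
          ring
  -- assemble
  calc ∫⁻ y, f y = (∫⁻ y in S, f y) + ∫⁻ y in Sᶜ, f y := (lintegral_add_compl f hSm).symm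
    _ = (∫⁻ y in S, f y) + ((∫⁻ y in Sᶜ ∩ T, f y) + ∫⁻ y in Sᶜ \ T, f y) := by
        rw [lintegral_inter_add_sdiff f Sᶜ hTm]
    _ ≤ ENNReal.ofReal (2 * V / ρ) + (ENNReal.ofReal (8 * V / ρ) + ENNReal.ofReal (2 * V / ρ)) :=
        add_le_add h1 (add_le_add h2 h3)
    _ = ENNReal.ofReal (12 * V / ρ) := by
        rw [← ENNReal.ofReal_add (by positivity) (by positivity), ← ENNReal.ofReal_add (by positivity) (by positivity)]
        congr 1
        ring

/-- Real-valued form: the weighted dipole integrand is integrable and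
`∫ |x − y|⁻² (1+|y|)⁻² dy ≤ 12 V/(1+|x|)`. -/
theorem integral_norm_sub_rpow_neg_two_mul_inv_weight_sq_le (x : EuclideanSpace ℝ (Fin 3)) :
    Integrable (fun y => ‖x - y‖ ^ (-(2:ℝ)) * ((1 + ‖y‖) ^ 2)⁻¹) (volume : Measure (EuclideanSpace ℝ (Fin 3))) ∧
    ∫ y, ‖x - y‖ ^ (-(2:ℝ)) * ((1 + ‖y‖) ^ 2)⁻¹ ≤
      12 * (3 * (volume : Measure (EuclideanSpace ℝ (Fin 3))).real (ball 0 1)) / (1 + ‖x‖) := by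
  have hV0 : 0 ≤ 3 * (volume : Measure (EuclideanSpace ℝ (Fin 3))).real (ball 0 1) := three_mul_volume_real_ball_nonneg
  have hρ0 : 0 < 1 + ‖x‖ := by linarith [norm_nonneg x]
  have hnn : ∀ y, 0 ≤ ‖x - y‖ ^ (-(2:ℝ)) * ((1 + ‖y‖) ^ 2)⁻¹ := fun y => by positivity
  have hmeas : AEStronglyMeasurable (fun y => ‖x - y‖ ^ (-(2:ℝ)) * ((1 + ‖y‖) ^ 2)⁻¹)
      (volume : Measure (EuclideanSpace ℝ (Fin 3))) := by
    refine (Measurable.mul ?_ ?_).aestronglyMeasurable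
    · exact ((continuous_const.sub continuous_id).norm.measurable).pow_const _
    · exact ((continuous_const.add continuous_norm).pow 2).measurable.inv
  have hlt := lintegral_norm_sub_rpow_neg_two_mul_inv_weight_sq_le x
  have hfin : HasFiniteIntegral (fun y => ‖x - y‖ ^ (-(2:ℝ)) * ((1 + ‖y‖) ^ 2)⁻¹)
      (volume : Measure (EuclideanSpace ℝ (Fin 3))) := by
    refine lt_of_le_of_lt ?_ (hlt.trans_lt ENNReal.ofReal_lt_top)
    refine lintegral_mono fun y => ?_
    rw [Real.enorm_eq_ofReal (hnn y)]
  have hint : Integrable (fun y => ‖x - y‖ ^ (-(2:ℝ)) * ((1 + ‖y‖) ^ 2)⁻¹)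
      (volume : Measure (EuclideanSpace ℝ (Fin 3))) := ⟨hmeas, hfin⟩
  refine ⟨hint, ?_⟩
  rw [integral_eq_lintegral_of_nonneg_ae (Eventually.of_forall hnn) hmeas]
  exact ENNReal.toReal_le_of_le_ofReal (by positivity) hlt

/-! ## The dipole potential of a `⟨y⟩⁻²` density -/

/-- Pointwise bound of the dipole integrand off the pole: `|∂ₐΓ(x − y) f(y)| ≤ (‖a‖ R/4π) |x − y|⁻² (1+|y|)⁻²` when
`(1+|y|)²|f(y)| ≤ R` and `y ≠ x`. -/
theorem abs_fderiv_newtonKernel_mul_le_of_sq_weight {f : EuclideanSpace ℝ (Fin 3) → ℝ} {R : ℝ}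
    (hf : ∀ y, (1 + ‖y‖) ^ 2 * |f y| ≤ R) (a : EuclideanSpace ℝ (Fin 3)) {x y : EuclideanSpace ℝ (Fin 3)} (hxy : y ≠ x) :
    |fderiv ℝ newtonKernel (x - y) a * f y| ≤ ‖a‖ * R / (4 * π) * (‖x - y‖ ^ (-(2:ℝ)) * ((1 + ‖y‖) ^ 2)⁻¹) := by
  have hne : x - y ≠ 0 := sub_ne_zero.2 (Ne.symm hxy)
  have hpos : 0 < ‖x - y‖ := norm_pos_iff.2 hne
  have hw : 0 < (1 + ‖y‖) ^ 2 := by positivity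
  have hfy : |f y| ≤ R * ((1 + ‖y‖) ^ 2)⁻¹ := by
    rw [← div_eq_mul_inv, le_div_iff₀ hw, mul_comm]; exact hf y
  have hK : |fderiv ℝ newtonKernel (x - y) a| ≤ (4 * π * ‖x - y‖ ^ 2)⁻¹ * ‖a‖ := by
    rw [← Real.norm_eq_abs, ← norm_fderiv_newtonKernel hne]; exact ContinuousLinearMap.le_opNorm _ _
  rw [abs_mul, rpow_neg hpos.le, rpow_two]
  calc |fderiv ℝ newtonKernel (x - y) a| * |f y|
      ≤ (4 * π * ‖x - y‖ ^ 2)⁻¹ * ‖a‖ * (R * ((1 + ‖y‖) ^ 2)⁻¹) :=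
        mul_le_mul hK hfy (abs_nonneg _) (by positivity)
    _ = ‖a‖ * R / (4 * π) * ((‖x - y‖ ^ 2)⁻¹ * ((1 + ‖y‖) ^ 2)⁻¹) := by
        field_simp

/-- **The dipole potential of a `⟨y⟩⁻²` density converges absolutely**: for a measurable real density with
`(1+|y|)²|f(y)| ≤ R`, `y ↦ ∂ₐΓ(x − y) f(y)` is integrable for every `x`. -/
theorem integrable_fderiv_newtonKernel_mul_of_sq_weight {f : EuclideanSpace ℝ (Fin 3) → ℝ}
    (hfm : AEStronglyMeasurable f (volume : Measure (EuclideanSpace ℝ (Fin 3)))) {R : ℝ}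
    (hf : ∀ y, (1 + ‖y‖) ^ 2 * |f y| ≤ R) (a x : EuclideanSpace ℝ (Fin 3)) :
    Integrable (fun y => fderiv ℝ newtonKernel (x - y) a * f y) (volume : Measure (EuclideanSpace ℝ (Fin 3))) := by
  have hb := (integral_norm_sub_rpow_neg_two_mul_inv_weight_sq_le x).1
  refine Integrable.mono' (hb.const_mul (‖a‖ * R / (4 * π))) ?_ ?_
  · refine AEStronglyMeasurable.mul ?_ hfm
    exact ((measurable_fderiv_apply_const ℝ newtonKernel a).comp
      (measurable_const.sub measurable_id)).aestronglyMeasurable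
  · have h0 : (volume : Measure (EuclideanSpace ℝ (Fin 3))) {x} = 0 := measure_singleton x
    filter_upwards [compl_mem_ae_iff.2 h0] with y hy
    have hyx : y ≠ x := by simpa using hy
    rw [Real.norm_eq_abs]
    exact abs_fderiv_newtonKernel_mul_le_of_sq_weight hf a hyx

/-- **The free pressure of the gate is bounded and decays**: for a real density with `(1+|y|)²|f(y)| ≤ R`,
`|T_a f(x)| = |∫ ∂ₐΓ(x − y) f(y) dy| ≤ (12 V/4π) ‖a‖ R/(1+|x|)`, `V = 3|B₁|`. -/
theorem abs_newtonGradPotential_le_of_sq_weight {f : EuclideanSpace ℝ (Fin 3) → ℝ} {R : ℝ}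
    (hf : ∀ y, (1 + ‖y‖) ^ 2 * |f y| ≤ R) (a x : EuclideanSpace ℝ (Fin 3)) :
    |newtonGradPotential a f x| ≤
      ‖a‖ * R / (4 * π) * (12 * (3 * (volume : Measure (EuclideanSpace ℝ (Fin 3))).real (ball 0 1)) / (1 + ‖x‖)) := by
  have hR : 0 ≤ R := le_trans (by positivity) (hf 0)
  obtain ⟨hb, hI⟩ := integral_norm_sub_rpow_neg_two_mul_inv_weight_sq_le x
  have h0 : (volume : Measure (EuclideanSpace ℝ (Fin 3))) {x} = 0 := measure_singleton x
  have hbound : ∀ᵐ y ∂(volume : Measure (EuclideanSpace ℝ (Fin 3))),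
      ‖fderiv ℝ newtonKernel (x - y) a * f y‖ ≤ ‖a‖ * R / (4 * π) * (‖x - y‖ ^ (-(2:ℝ)) * ((1 + ‖y‖) ^ 2)⁻¹) := by
    filter_upwards [compl_mem_ae_iff.2 h0] with y hy
    have hyx : y ≠ x := by simpa using hy
    rw [Real.norm_eq_abs]
    exact abs_fderiv_newtonKernel_mul_le_of_sq_weight hf a hyx
  unfold newtonGradPotential
  simp only [smul_eq_mul]
  rw [← Real.norm_eq_abs]
  calc ‖∫ y, fderiv ℝ newtonKernel (x - y) a * f y‖
      ≤ ∫ y, ‖a‖ * R / (4 * π) * (‖x - y‖ ^ (-(2:ℝ)) * ((1 + ‖y‖) ^ 2)⁻¹) :=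
        norm_integral_le_of_norm_le (hb.const_mul _) hbound
    _ = ‖a‖ * R / (4 * π) * ∫ y, ‖x - y‖ ^ (-(2:ℝ)) * ((1 + ‖y‖) ^ 2)⁻¹ := integral_const_mul _ _
    _ ≤ ‖a‖ * R / (4 * π) * (12 * (3 * (volume : Measure (EuclideanSpace ℝ (Fin 3))).real (ball 0 1)) / (1 + ‖x‖)) :=
        mul_le_mul_of_nonneg_left hI (by positivity)

end Summit.NavierStokesRegularity.NavierStokesRegularity.Theorems.KelvinGate

end
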